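import Summits.QuantumFields.YangMills.Theorems.BalabanUVNodesN12BjRootChainsGraded
import Summits.QuantumFields.YangMills.Theorems.BalabanUVNodesN12BjAcrossChainsLam
import HarnessLib

/-!
# BalabanUVNodes ∕ N12 — (G-c)ᴸᵃᵐ part 2∕2: ROOT CHAINS AT PRINT's DATUM `Λ_j(Z) = lamBondsSeq (maxDomT M₁ Z) k j` ([Balaban1984PropagatorsII] (2.3)) — the centre-to-centre chains and
# the root chains of dag-n12-w3's `…N12BjRootChains(Graded)` RE-CERTIFIED LINK BY LINK as chains of PRINT members (part 1∕2 = `…N12BjAcrossChainsLam`): the word datum of dag-n12-w6's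
# root-transporter letter `hT` at print's datum, where the (2.12) constraint pins the member averages ONLY on `Λ(Z)`'s bonds — (F) head of the (ii) re-attachment (dag-lead WORDS 423)

[Balaban1984PropagatorsII] = «[II]», (2.3) p. 224 (print's `Λ_j`: the bonds of the `j`-lattice in `Ω_j ∖ Ω_{j+1}` together with the OUTWARD connectors; the inward connectors — a `j`-bond
with an end-point block deep in `Ω_{j+1}` — are NOT constrained); [Balaban1988Convergent] = «[III]», (2.2) p. 255, (2.13) pp. 256–257 (the maximal sequence `Ω_j(Z)`, the collar
`dist(Ω_{j+1}, Ω_jᶜ) ≥ L^{j+1}M₁`); [Balaban1985Variational] = «[15]», (3)–(4) p. 278, (16)–(18) p. 280 (the residual axial gauge between the points of `𝔅_k`, read along chains of constrained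
bonds); [Balaban1985RegularSpaces] = «[6]», (1.7) p. 77, (1.19) p. 79.

Cell `pub-ymgap` (HUMAN RULINGS D-0062 ∕ D-0149), lane `pub-ymgap-dag-n12-c` g37 (R134 seat (a), N12 = [B15], s1, lane owner; (F)-share by dag-lead WORDS 423); `--kind proof --supports` K1⁹
`stmt-QuantumFields-27364` `--as helper`; count-neutral.  THEOREMS ONLY (0 `def`, 0 `instance`, 0 `sorry`); by name over dag-n12-w3's `…N12BjAcrossChains` (`mem_Bj_pred_of_outside`,
`mem_bondsOf_of_outside`, `embIter_not_mem_maxDomT_succ`, `iterBlockOf_ne_of_mem_not_mem`, the one-link lemmas), `…N12BjCollarRoots`, `…N12BlockChains`, `…N12BjRootChainsGraded`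
(statement shapes), `…N12FlatHndRecordLetters.hcov_Bj`, and this lane's ✓p776611∕p776747 `B15DeterminingSetsBEndpoints` (the MEMBERSHIP CRITERION `mem_lamBondsSeq_maxDomT_of_embIter_not_mem`
and `embIter_not_mem_of_mem_lamBondsSeq`).  §2∕§3∕§5 are the parents' proof texts (tree bytes, block-extracted by `work/gen_rootchains_lam.py`) with the two membership certificates exchanged.

WHY.  dag-n12-w6's root-transporter letter `hT` (`…N12RootTransporterBj(B)`: the transport of `U₀` along a chain of constrained bonds is within `#links·θ` of a product of the member
AVERAGES, themselves `δ₁`-near `1` by the DATUM letter) needs, at print's datum, chains whose links are PRINT members: the (2.12) constraint `M_Λ(U₀) = V` pins the averages of the minimiser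
ONLY on `Λ_j(Z)`'s bonds (the lane's LOCATED of 2026-08-30: the inward connectors are free variables of print's variational problem), so the (b)-chains of `…N12BjRootChains` — which reach a
face-layer root through the INWARD connector — do not carry the datum letter.  THIS FILE shows the repair costs nothing: (i) the coarse link of a chain across `∂Ω_{n+1}` is the OUTWARD
connector (both end-centres off `Ω_{n+2}` ∕ `Ω_{n+1}`), the fine links inside the outside neighbour block have both end-centres off `Ω_{n+1}`, and a same-level link between two
`Γ_J`-blocks has both end-centres off `Ω_{J+1}` — all PRINT members by the lane's membership criterion; (ii) at print's datum the (CENTRE) clause's face-layer alternative never fires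
(`not_faceLayer_lamBondsSeq`), i.e. EVERY root is the centre `ι_J(B^J z)` of the `Γ`-level block — print's root set `{ι_j c± : c ∈ Λ_j}` contains every `Γ_j^{(j)}`-centre
(`B15DeterminingSetsBEndpoints.exists_mem_lamBondsSeq_maxDomT_of_mem_Bj`) and no face-layer point —, so the root chain IS the centre-to-centre chain.

CONTENTS (namespace `Summit.QuantumFields.YangMills.BalabanUVNodes.N12BjRootChainsLam`; part 1∕2 = `…N12BjAcrossChainsLam`: membership certificates + chains across `∂Ω_{n+1}`).
§3 ★★ `exists_chain_centre_centre_lam_graded` (+ `exists_chain_centre_centre_lam`).  §4 `exists_chain_root_centre_lam_graded` (+ `exists_chain_root_centre_lam`; both chains EMPTY — the root is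
the centre).  §5 ★★★ `exists_rootChain_lamBondsSeq_graded`, ★★★ `exists_rootChain_lamBondsSeq` (dag-n12-w6's `hT` word datum at print's datum: the parents' binders with `bondsOf (𝐁_k(Z)_i)` ↦
`Λ_i(Z)` in the (CENTRE) clause and in the membership of the links), and the root-map-free edition `exists_rootChain_lamBondsSeq_graded_centre` (roots := the `Γ`-level centres, no
`root`∕`hcentre` binder), ★★ `exists_rootChain_lamBondsSeq_graded_touching` (bonds TOUCHING `Ω₁(Z)`: the CROSSING bonds of LOCATED-2 included).  §3∕§5 are the parents' proof texts (tree bytes, block-extracted by `work/gen_rootchains_lam.py`) with the membership certificates exchanged.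

HONEST FRAMING.  Finite lattice bookkeeping by name over landed kernel theorems; no analysis; nothing of Bałaban's estimates asserted or refuted; count-neutral helper (`--supports 27364`);
N12 NOT discharged; K0⁷∕K1⁹ NOT closed; counts of record unmoved (typed 28∕28 · discharged 8∕27); one finite 𝕋⁴ programme at fixed ε — R4 closes the conditional rung `BalabanLadder.UV`
only; the Yang–Mills mass gap (Clay) is NOT proved by any of this; nothing continuum ∕ ℝ⁴ ∕ OS.
-/

noncomputable section

namespace Summit.QuantumFields.YangMills.BalabanUVNodes.N12BjRootChainsLam

open scoped BigOperators
open Literature.MathematicalPhysics.QuantumFieldTheory.Balaban1983to89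
open T4Continuum
open B15DeterminingSets B15DeterminingSetsB
open B15DeterminingSetsBEndpoints (mem_lamBondsSeq_maxDomT_of_embIter_not_mem embIter_not_mem_of_mem_lamBondsSeq)
open B5Eq118OneStroke (iterBlockOf iterBlockOf_succ)
open B14.Eq213MaximalDomains (side)
open B14.Eq213DetSet (Bj Bj_zero Bj_mid Bj_top Bj_of_gt maxDomT maxDomT_antitone isBlockUnion_maxDomT)
open Literature.MathematicalPhysics.QuantumFieldTheory.BalabanImbrieJaffe1984to88.BIJ88RT51Background (iterBlockOf_embIter)
open Summit.QuantumFields.YangMills.BalabanUVNodes.N07CritMultiScaleLamBond (iterBlockOf_congr_of_le)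
open Summit.QuantumFields.YangMills.BalabanUVNodes.N12FlatHndRecordLetters (hcov_Bj)
open Summit.QuantumFields.YangMills.BalabanUVNodes.N12BjCollarRoots
open Summit.QuantumFields.YangMills.BalabanUVNodes.N12BlockChains
open Summit.QuantumFields.YangMills.BalabanUVNodes.N12BjAcrossChains
open B6CubeRightLegsV1 (iterBlockOf_shift_or)

variable {P : Params}
open Summit.QuantumFields.YangMills.BalabanUVNodes.N12BjAcrossChainsLam

/-! ## §3  Centre to centre across a fine bond, through print members -/

section CentreCentre

variable {M₁ k : ℕ} {Z : Set (Site P 0)}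

/-- ★★ **CENTRE ⇝ CENTRE ACROSS A FINE BOND THROUGH PRINT MEMBERS, GRADED** — `N12BjRootChainsGraded.exists_chain_centre_centre_graded` with every link a member of PRINT's datum
`lamBondsSeq (maxDomT M₁ Z) k`.  For a fine bond `b` whose ends have member blocks of levels `J ≥ 1` and `J′`: the centres `ι_J(B^J b₋)`, `ι_{J′}(B^{J′} b₊)` are EQUAL, or the two blocks are
adjacent members of the same level — the `J`-bond joining them has BOTH ends in `Γ_J^{(J)}`, hence both end-centres off `Ω_{J+1}`, hence is a PRINT member (`adjacent_mem_lamBondsSeq`) —, or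
`|J − J′| = 1` and the bond crosses `∂Ω_{max}` (`exists_chain_across_lam_graded`).  `|J − J′| ≤ 1` exported; a chain of `≤ d·(L−1)∕2 + 1` print links of grade `≤ J + 1`, `≤ J′ + 1`.
[cite: Balaban1984PropagatorsII, (2.3) p.224; Balaban1988Convergent, (2.2) p.255, (2.13) pp.256–257; Balaban1985Variational, (16)–(18) p.280] -/
theorem exists_chain_centre_centre_lam_graded (hM2 : 2 ≤ M₁) (hdiv : side P.L M₁ k ∣ P.sitesPerDir 0) (hk : k ≤ P.m + P.K) (b : PBond P 0) {J J' : ℕ} (hJ1 : 1 ≤ J)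
    (hJ : iterBlockOf J b.src ∈ (Bj M₁ Z k : DetSet P) J) (hJ' : iterBlockOf J' b.tgt ∈ (Bj M₁ Z k : DetSet P) J') :
    (J ≤ J' + 1 ∧ J' ≤ J + 1) ∧ ∃ links : List ((m : ℕ) × (PBond P m × Bool)), links.length ≤ P.d * ((P.L - 1) / 2) + 1 ∧
      (∀ l ∈ links, l.1 ≤ J + 1 ∧ l.1 ≤ J' + 1 ∧ l.1 ≤ k ∧ l.2.1 ∈ lamBondsSeq (maxDomT M₁ Z) k l.1) ∧
      walkEnd (embIter J (iterBlockOf J b.src)) (links.map fun l => List.replicate (P.L ^ l.1) (l.2.1.dir, l.2.2)).flatten = embIter J' (iterBlockOf J' b.tgt) ∧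
      ∀ (pre post : List ((m : ℕ) × (PBond P m × Bool))) (l : (m : ℕ) × (PBond P m × Bool)), links = pre ++ l :: post →
        (l.2.2 = true → walkEnd (embIter J (iterBlockOf J b.src)) (pre.map fun l => List.replicate (P.L ^ l.1) (l.2.1.dir, l.2.2)).flatten = embIter l.1 l.2.1.src) ∧
        (l.2.2 = false → walkEnd (embIter J (iterBlockOf J b.src)) (pre.map fun l => List.replicate (P.L ^ l.1) (l.2.1.dir, l.2.2)).flatten = embIter l.1 l.2.1.tgt) := by
  have hM : 1 ≤ M₁ := by omega
  have hJk : J ≤ k := le_of_iterBlockOf_mem_Bj hJ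
  have htgt : (b.tgt : Site P 0) = b.src.shift b.dir := rfl
  have hsΩ : b.src ∈ maxDomT M₁ Z J := mem_maxDomT_of_iterBlockOf_mem_Bj hM hdiv hk hJ1 hJ
  have hor : iterBlockOf J b.tgt = iterBlockOf J b.src ∨ iterBlockOf J b.tgt = (iterBlockOf J b.src).shift b.dir := by
    rw [htgt]; exact iterBlockOf_shift_or J (hJk.trans hk) b.src b.dir
  by_cases htJ : iterBlockOf J b.tgt ∈ (Bj M₁ Z k : DetSet P) J
  · -- same level
    have hJJ' : J = J' := eq_of_iterBlockOf_mem_Bj hM hdiv hk htJ hJ'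
    subst hJJ'
    rcases hor with heq | hsh
    · refine ⟨⟨Nat.le_succ J, Nat.le_succ J⟩, [], by simp, fun l hl => absurd hl List.not_mem_nil, by rw [heq]; rfl, fun pre post l h => ?_⟩
      simp at h
    · have hst : ((⟨J, ⟨iterBlockOf J b.src, b.dir⟩, true⟩ : (m : ℕ) × (PBond P m × Bool)).2.2 = true →
            embIter J (iterBlockOf J b.src) = embIter J (PBond.src ⟨iterBlockOf J b.src, b.dir⟩)) ∧
          ((⟨J, ⟨iterBlockOf J b.src, b.dir⟩, true⟩ : (m : ℕ) × (PBond P m × Bool)).2.2 = false →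
            embIter J (iterBlockOf J b.src) = embIter J (PBond.tgt ⟨iterBlockOf J b.src, b.dir⟩)) := ⟨fun _ => rfl, fun h => absurd h (by simp)⟩
      refine ⟨⟨Nat.le_succ J, Nat.le_succ J⟩, [⟨J, ⟨iterBlockOf J b.src, b.dir⟩, true⟩], by simp, fun l hl => ?_, ?_, cons_single _ _ hst⟩
      · rw [List.mem_singleton.mp hl]
        have htJ' : (iterBlockOf J b.src).shift b.dir ∈ (Bj M₁ Z k : DetSet P) J := hsh ▸ htJ
        exact ⟨Nat.le_succ J, Nat.le_succ J, hJk, adjacent_mem_lamBondsSeq hM2 hdiv hk hJ htJ'⟩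
      · rw [walkEnd_single _ _ hst, hsh]; simp; rfl
  · by_cases htΩ : b.tgt ∈ maxDomT M₁ Z J
    · -- `b₊ ∈ Ω_J` with a non-member `J`-block: `b₊ ∈ Ω_{J+1}`, `J′ = J + 1`, and `b₋ ∉ Ω_{J+1}`
      have hUJ := B14.Eq213DetSet.isBlockUnion_maxDomT hM (Ω := Z) hdiv hJ1 hJk (hJk.trans hk)
      have hJk' : J < k := by
        by_contra h
        have hJk2 : J = k := le_antisymm hJk (not_lt.mp h)
        subst hJk2
        apply htJ
        rw [Bj_top]
        have h1 := (hUJ b.tgt).1 htΩ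
        rw [N12FlatHndRecordLetters.blockIter_eq_iterBlockOf] at h1
        exact h1
      have htΩ1 : b.tgt ∈ maxDomT M₁ Z (J + 1) := by
        by_contra h1
        apply htJ
        rw [Bj_mid (by omega) hJk']
        refine ⟨?_, fun h2 => h1 ?_⟩
        · have h3 := (hUJ b.tgt).1 htΩ
          rw [N12FlatHndRecordLetters.blockIter_eq_iterBlockOf] at h3
          exact h3
        · have hU1 := B14.Eq213DetSet.isBlockUnion_maxDomT_succ hM (Ω := Z) hdiv (show J + 1 ≤ k by omega) (hJk.trans hk)
          rw [hU1 b.tgt, N12FlatHndRecordLetters.blockIter_eq_iterBlockOf]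
          exact h2
      have hJ'1 : 1 ≤ J' := by
        by_contra h0
        have hJ'0 : J' = 0 := by omega
        subst hJ'0
        rw [Bj_zero (by omega)] at hJ'
        exact hJ' (maxDomT_antitone hM Z (by omega : 1 ≤ J + 1) htΩ1)
      have hge : J + 1 ≤ J' := by
        by_contra h
        exact not_mem_maxDomT_of_iterBlockOf_mem_Bj hM hdiv hk (show J' < J + 1 by omega) (by omega) hJ' htΩ1
      have hle : J' ≤ J + 1 := by
        by_contra h
        have htΩ' : b.tgt ∈ maxDomT M₁ Z J' := mem_maxDomT_of_iterBlockOf_mem_Bj hM hdiv hk hJ'1 hJ'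
        have hJ'k : J' ≤ k := le_of_iterBlockOf_mem_Bj hJ'
        have hsΩ' : b.src ∈ maxDomT M₁ Z (J' - 1) :=
          mem_maxDomT_pred_of_blockIdx hM2 hdiv hk hJ'1 (le_of_iterBlockOf_mem_Bj hJ') (i := 0) (Nat.zero_le _) htΩ'
            (fun κ => idx_adj_of_bond b (Or.inr rfl) (Or.inl rfl) κ)
        exact not_mem_maxDomT_of_iterBlockOf_mem_Bj hM hdiv hk (show J < J' - 1 by omega) (by omega) hJ hsΩ'
      have hJ'eq : J' = J + 1 := le_antisymm hle hge
      subst hJ'eq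
      have hsΩ1 : b.src ∉ maxDomT M₁ Z (J + 1) := not_mem_maxDomT_of_iterBlockOf_mem_Bj hM hdiv hk (Nat.lt_succ_self J) (by omega) hJ
      have hor1 : iterBlockOf (J + 1) b.tgt = iterBlockOf (J + 1) b.src ∨ iterBlockOf (J + 1) b.tgt = (iterBlockOf (J + 1) b.src).shift b.dir := by
        rw [htgt]; exact iterBlockOf_shift_or (J + 1) (by omega) b.src b.dir
      have hne1 : iterBlockOf (J + 1) b.tgt ≠ iterBlockOf (J + 1) b.src := iterBlockOf_ne_of_mem_not_mem hM2 hdiv hk (by omega) (by omega) htΩ1 hsΩ1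
      have hsh1 : iterBlockOf (J + 1) b.tgt = (iterBlockOf (J + 1) b.src).shift b.dir := hor1.resolve_left hne1
      obtain ⟨-, -, ⟨links, hlen, hmem, hend, hcons⟩⟩ := exists_chain_across_lam_graded hM2 hdiv hk (n := J) (by omega) hJ' hsΩ1 ⟨iterBlockOf (J + 1) b.src, b.dir⟩ (Or.inr ⟨hsh1.symm, rfl⟩)
      exact ⟨⟨by omega, by omega⟩, links, hlen, fun l hl => ⟨(hmem l hl).1, (hmem l hl).1.trans (Nat.le_succ _), (hmem l hl).2⟩, hend, hcons⟩
    · -- `b₊ ∉ Ω_J`: `J′ = J − 1`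
      obtain ⟨n, rfl⟩ : ∃ n, J = n + 1 := ⟨J - 1, by omega⟩
      have hne : iterBlockOf (n + 1) b.tgt ≠ iterBlockOf (n + 1) b.src := (iterBlockOf_ne_of_mem_not_mem hM2 hdiv hk hJ1 hJk hsΩ htΩ).symm
      have hsh : iterBlockOf (n + 1) b.tgt = (iterBlockOf (n + 1) b.src).shift b.dir := hor.resolve_left hne
      obtain ⟨hmemt, ⟨links, hlen, hmem, hend, hcons⟩, -⟩ := exists_chain_across_lam_graded hM2 hdiv hk (n := n) hJk hJ htΩ ⟨iterBlockOf (n + 1) b.src, b.dir⟩ (Or.inl ⟨rfl, hsh.symm⟩)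
      have hJ'eq : J' = n := eq_of_iterBlockOf_mem_Bj hM hdiv hk hJ' hmemt
      subst hJ'eq
      exact ⟨⟨by omega, by omega⟩, links, hlen, fun l hl => ⟨(hmem l hl).1.trans (Nat.le_succ _), (hmem l hl).1, (hmem l hl).2⟩, hend, hcons⟩

/-- **CENTRE ⇝ CENTRE THROUGH PRINT MEMBERS** (ungraded form, the shape of `N12BjRootChains.exists_chain_centre_centre`). [cite: Balaban1984PropagatorsII, (2.3) p.224; Balaban1988Convergent, (2.2) p.255, (2.13) pp.256–257; Balaban1985Variational, (16)–(18) p.280] -/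
theorem exists_chain_centre_centre_lam (hM2 : 2 ≤ M₁) (hdiv : side P.L M₁ k ∣ P.sitesPerDir 0) (hk : k ≤ P.m + P.K) (b : PBond P 0) {J J' : ℕ} (hJ1 : 1 ≤ J)
    (hJ : iterBlockOf J b.src ∈ (Bj M₁ Z k : DetSet P) J) (hJ' : iterBlockOf J' b.tgt ∈ (Bj M₁ Z k : DetSet P) J') :
    ∃ links : List ((m : ℕ) × (PBond P m × Bool)), links.length ≤ P.d * ((P.L - 1) / 2) + 1 ∧
      (∀ l ∈ links, l.1 ≤ k ∧ l.2.1 ∈ lamBondsSeq (maxDomT M₁ Z) k l.1) ∧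
      walkEnd (embIter J (iterBlockOf J b.src)) (links.map fun l => List.replicate (P.L ^ l.1) (l.2.1.dir, l.2.2)).flatten = embIter J' (iterBlockOf J' b.tgt) ∧
      ∀ (pre post : List ((m : ℕ) × (PBond P m × Bool))) (l : (m : ℕ) × (PBond P m × Bool)), links = pre ++ l :: post →
        (l.2.2 = true → walkEnd (embIter J (iterBlockOf J b.src)) (pre.map fun l => List.replicate (P.L ^ l.1) (l.2.1.dir, l.2.2)).flatten = embIter l.1 l.2.1.src) ∧
        (l.2.2 = false → walkEnd (embIter J (iterBlockOf J b.src)) (pre.map fun l => List.replicate (P.L ^ l.1) (l.2.1.dir, l.2.2)).flatten = embIter l.1 l.2.1.tgt) := by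
  obtain ⟨-, links, hlen, hmem, hend, hcons⟩ := exists_chain_centre_centre_lam_graded hM2 hdiv hk b hJ1 hJ hJ'
  exact ⟨links, hlen, fun l hl => ⟨(hmem l hl).2.2.1, (hmem l hl).2.2.2⟩, hend, hcons⟩

end CentreCentre

/-! ## §4  Root to centre at print's datum: the empty chain -/

section RootCentre

variable {M₁ k : ℕ} {Z : Set (Site P 0)}

/-- **ROOT ⇝ CENTRE AND CENTRE ⇝ ROOT AT PRINT's DATUM, GRADED** — `N12BjRootChainsGraded.exists_chain_root_centre_graded` with the (CENTRE) clause and the memberships read at print's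
datum: the face-layer alternative is void (`not_faceLayer_lamBondsSeq`), the root IS the centre `ι_J(B^J z)`, and both chains are EMPTY (the parent's off-face-layer case, verbatim).
[cite: Balaban1984PropagatorsII, (2.3) p.224; Balaban1988Convergent, (2.2) p.255, (2.13) pp.256–257; Balaban1985Variational, (3)–(4) p.278, (16)–(18) p.280] -/
theorem exists_chain_root_centre_lam_graded (hM2 : 2 ≤ M₁) (hdiv : side P.L M₁ k ∣ P.sitesPerDir 0) (hk : k ≤ P.m + P.K) {J : ℕ} (hJ1 : 1 ≤ J)
    {z : Site P 0} (hz : iterBlockOf J z ∈ (Bj M₁ Z k : DetSet P) J) (root : Site P 0 → Site P 0)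
    (hcentre : ((1 ≤ J ∧ ∃ c ∈ lamBondsSeq (maxDomT M₁ Z) k (J - 1), (iterBlockOf (J - 1) z = c.src ∨ iterBlockOf (J - 1) z = c.tgt)) ∧
        root z = embIter (J - 1) (iterBlockOf (J - 1) z)) ∨
      (¬ (1 ≤ J ∧ ∃ c ∈ lamBondsSeq (maxDomT M₁ Z) k (J - 1), (iterBlockOf (J - 1) z = c.src ∨ iterBlockOf (J - 1) z = c.tgt)) ∧
        root z = embIter J (iterBlockOf J z))) :
    (∃ links : List ((m : ℕ) × (PBond P m × Bool)), links.length ≤ P.d * ((P.L - 1) / 2) + 2 ∧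
      (∀ l ∈ links, l.1 ≤ J ∧ l.1 ≤ k ∧ l.2.1 ∈ lamBondsSeq (maxDomT M₁ Z) k l.1) ∧
      walkEnd (root z) (links.map fun l => List.replicate (P.L ^ l.1) (l.2.1.dir, l.2.2)).flatten = embIter J (iterBlockOf J z) ∧
      ∀ (pre post : List ((m : ℕ) × (PBond P m × Bool))) (l : (m : ℕ) × (PBond P m × Bool)), links = pre ++ l :: post →
        (l.2.2 = true → walkEnd (root z) (pre.map fun l => List.replicate (P.L ^ l.1) (l.2.1.dir, l.2.2)).flatten = embIter l.1 l.2.1.src) ∧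
        (l.2.2 = false → walkEnd (root z) (pre.map fun l => List.replicate (P.L ^ l.1) (l.2.1.dir, l.2.2)).flatten = embIter l.1 l.2.1.tgt)) ∧
    (∃ links : List ((m : ℕ) × (PBond P m × Bool)), links.length ≤ P.d * ((P.L - 1) / 2) + 2 ∧
      (∀ l ∈ links, l.1 ≤ J ∧ l.1 ≤ k ∧ l.2.1 ∈ lamBondsSeq (maxDomT M₁ Z) k l.1) ∧
      walkEnd (embIter J (iterBlockOf J z)) (links.map fun l => List.replicate (P.L ^ l.1) (l.2.1.dir, l.2.2)).flatten = root z ∧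
      ∀ (pre post : List ((m : ℕ) × (PBond P m × Bool))) (l : (m : ℕ) × (PBond P m × Bool)), links = pre ++ l :: post →
        (l.2.2 = true → walkEnd (embIter J (iterBlockOf J z)) (pre.map fun l => List.replicate (P.L ^ l.1) (l.2.1.dir, l.2.2)).flatten = embIter l.1 l.2.1.src) ∧
        (l.2.2 = false → walkEnd (embIter J (iterBlockOf J z)) (pre.map fun l => List.replicate (P.L ^ l.1) (l.2.1.dir, l.2.2)).flatten = embIter l.1 l.2.1.tgt)) := by
  rw [root_eq_centre_of_hcentre_lam hM2 hdiv hk hJ1 hz hcentre]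
  refine ⟨⟨[], by simp, fun l hl => absurd hl List.not_mem_nil, rfl, fun pre post l h => ?_⟩,
    ⟨[], by simp, fun l hl => absurd hl List.not_mem_nil, rfl, fun pre post l h => ?_⟩⟩ <;> simp at h

/-- **ROOT ⇝ CENTRE AND BACK AT PRINT's DATUM** (ungraded form of `exists_chain_root_centre_lam_graded`, the shape of `N12BjRootChains.exists_chain_root_centre`).
[cite: Balaban1984PropagatorsII, (2.3) p.224; Balaban1988Convergent, (2.13) pp.256–257; Balaban1985Variational, (3)–(4) p.278] -/
theorem exists_chain_root_centre_lam (hM2 : 2 ≤ M₁) (hdiv : side P.L M₁ k ∣ P.sitesPerDir 0) (hk : k ≤ P.m + P.K) {J : ℕ} (hJ1 : 1 ≤ J)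
    {z : Site P 0} (hz : iterBlockOf J z ∈ (Bj M₁ Z k : DetSet P) J) (root : Site P 0 → Site P 0)
    (hcentre : ((1 ≤ J ∧ ∃ c ∈ lamBondsSeq (maxDomT M₁ Z) k (J - 1), (iterBlockOf (J - 1) z = c.src ∨ iterBlockOf (J - 1) z = c.tgt)) ∧
        root z = embIter (J - 1) (iterBlockOf (J - 1) z)) ∨
      (¬ (1 ≤ J ∧ ∃ c ∈ lamBondsSeq (maxDomT M₁ Z) k (J - 1), (iterBlockOf (J - 1) z = c.src ∨ iterBlockOf (J - 1) z = c.tgt)) ∧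
        root z = embIter J (iterBlockOf J z))) :
    (∃ links : List ((m : ℕ) × (PBond P m × Bool)), links.length ≤ P.d * ((P.L - 1) / 2) + 2 ∧
      (∀ l ∈ links, l.1 ≤ k ∧ l.2.1 ∈ lamBondsSeq (maxDomT M₁ Z) k l.1) ∧
      walkEnd (root z) (links.map fun l => List.replicate (P.L ^ l.1) (l.2.1.dir, l.2.2)).flatten = embIter J (iterBlockOf J z) ∧
      ∀ (pre post : List ((m : ℕ) × (PBond P m × Bool))) (l : (m : ℕ) × (PBond P m × Bool)), links = pre ++ l :: post →
        (l.2.2 = true → walkEnd (root z) (pre.map fun l => List.replicate (P.L ^ l.1) (l.2.1.dir, l.2.2)).flatten = embIter l.1 l.2.1.src) ∧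
        (l.2.2 = false → walkEnd (root z) (pre.map fun l => List.replicate (P.L ^ l.1) (l.2.1.dir, l.2.2)).flatten = embIter l.1 l.2.1.tgt)) ∧
    (∃ links : List ((m : ℕ) × (PBond P m × Bool)), links.length ≤ P.d * ((P.L - 1) / 2) + 2 ∧
      (∀ l ∈ links, l.1 ≤ k ∧ l.2.1 ∈ lamBondsSeq (maxDomT M₁ Z) k l.1) ∧
      walkEnd (embIter J (iterBlockOf J z)) (links.map fun l => List.replicate (P.L ^ l.1) (l.2.1.dir, l.2.2)).flatten = root z ∧
      ∀ (pre post : List ((m : ℕ) × (PBond P m × Bool))) (l : (m : ℕ) × (PBond P m × Bool)), links = pre ++ l :: post →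
        (l.2.2 = true → walkEnd (embIter J (iterBlockOf J z)) (pre.map fun l => List.replicate (P.L ^ l.1) (l.2.1.dir, l.2.2)).flatten = embIter l.1 l.2.1.src) ∧
        (l.2.2 = false → walkEnd (embIter J (iterBlockOf J z)) (pre.map fun l => List.replicate (P.L ^ l.1) (l.2.1.dir, l.2.2)).flatten = embIter l.1 l.2.1.tgt)) := by
  obtain ⟨⟨L₁, h1len, h1mem, h1end, h1cons⟩, ⟨L₂, h2len, h2mem, h2end, h2cons⟩⟩ :=
    exists_chain_root_centre_lam_graded hM2 hdiv hk hJ1 hz root hcentre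
  exact ⟨⟨L₁, h1len, fun l hl => (h1mem l hl).2, h1end, h1cons⟩, ⟨L₂, h2len, fun l hl => (h2mem l hl).2, h2end, h2cons⟩⟩

end RootCentre

/-! ## §5  The root chains at print's datum -/

section Main

variable {M₁ k : ℕ} {Z : Set (Site P 0)}

/-- ★★★ **(G-c)ᴸᵃᵐ THE ROOT CHAINS AT PRINT's DATUM `Λ(Z) = lamBondsSeq (maxDomT M₁ Z) k`, GRADED** — `N12BjRootChainsGraded.exists_rootChain_Bj_graded` BINDER FOR BINDER with the (CENTRE)
clause `hcentre` and the membership of every link read at PRINT's datum ([II] (2.3): the inward connectors are dropped).  `1 ≤ k ≤ m + K`, `M₁ ≥ 2`, cover divisibility; `root` any root map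
with the print (CENTRE) clause — whose face-layer alternative is VOID at print's datum (`not_faceLayer_lamBondsSeq`: no bond of `Λ_{J−1}` touches the `(J−1)`-block of a site whose `J`-block is
in `Γ_J`), so `root z = ι_J(B^J z)` at every site read; the `Γ`-levels `J`, `J′` of the two ends of `b` as inputs.  THEN a chain of `≤ 3·d·(L−1)∕2 + 5` links `⟨i, c, ±⟩`, each a PRINT
MEMBER `c ∈ Λ_i(Z)` of level `i ≤ k`, grades `≤ J + 1`, `≤ J′ + 1`, segment words consecutive from `root b₋` (the `pre ++ l :: post` addressing) and ending at `root b₊` — the word datum of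
dag-n12-w6's root-transporter letter `hT` whose member-average letter the PRINT constraint `M_Λ(U₀) = V` supplies on exactly these links (`…N12RootTransporterBjB.transporter_of_links`
at `𝔅 := Λ(Z)`); the chains are the centre-to-centre chains, the parent's bound is kept for the consumers' arithmetic.
[cite: Balaban1984PropagatorsII, (2.3) p.224; Balaban1988Convergent, (2.2) p.255, (2.13) pp.256–257; Balaban1985Variational, (3)–(4) p.278, (16)–(18) p.280; Balaban1985RegularSpaces, (1.19) p.79] -/
theorem exists_rootChain_lamBondsSeq_graded (hk : k ≤ P.m + P.K) (hk1 : 1 ≤ k) (hM2 : 2 ≤ M₁) (hdiv : side P.L M₁ k ∣ P.sitesPerDir 0) (root : Site P 0 → Site P 0)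
    (hcentre : ∀ (z : Site P 0) (J : ℕ), iterBlockOf J z ∈ (Bj M₁ Z k : DetSet P) J →
      ((1 ≤ J ∧ ∃ c ∈ lamBondsSeq (maxDomT M₁ Z) k (J - 1), (iterBlockOf (J - 1) z = c.src ∨ iterBlockOf (J - 1) z = c.tgt)) ∧
          root z = embIter (J - 1) (iterBlockOf (J - 1) z)) ∨
      (¬ (1 ≤ J ∧ ∃ c ∈ lamBondsSeq (maxDomT M₁ Z) k (J - 1), (iterBlockOf (J - 1) z = c.src ∨ iterBlockOf (J - 1) z = c.tgt)) ∧
          root z = embIter J (iterBlockOf J z)))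
    (b : PBond P 0) (hbs : b.src ∈ maxDomT M₁ Z 1) (hbt : b.tgt ∈ maxDomT M₁ Z 1)
    {J J' : ℕ} (hJ : iterBlockOf J b.src ∈ (Bj M₁ Z k : DetSet P) J) (hJ' : iterBlockOf J' b.tgt ∈ (Bj M₁ Z k : DetSet P) J') :
    ∃ links : List ((m : ℕ) × (PBond P m × Bool)), links.length ≤ 3 * (P.d * ((P.L - 1) / 2)) + 5 ∧
      (∀ l ∈ links, l.1 ≤ k ∧ l.2.1 ∈ lamBondsSeq (maxDomT M₁ Z) k l.1) ∧
      (∀ l ∈ links, l.1 ≤ J + 1 ∧ l.1 ≤ J' + 1) ∧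
      walkEnd (root b.src) (links.map fun l => List.replicate (P.L ^ l.1) (l.2.1.dir, l.2.2)).flatten = root b.tgt ∧
      ∀ (pre post : List ((m : ℕ) × (PBond P m × Bool))) (l : (m : ℕ) × (PBond P m × Bool)), links = pre ++ l :: post →
        (l.2.2 = true → walkEnd (root b.src) (pre.map fun l => List.replicate (P.L ^ l.1) (l.2.1.dir, l.2.2)).flatten = embIter l.1 l.2.1.src) ∧
        (l.2.2 = false → walkEnd (root b.src) (pre.map fun l => List.replicate (P.L ^ l.1) (l.2.1.dir, l.2.2)).flatten = embIter l.1 l.2.1.tgt) := by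
  have hM : 1 ≤ M₁ := by omega
  have hlev : ∀ {z : Site P 0} {I : ℕ}, z ∈ maxDomT M₁ Z 1 → iterBlockOf I z ∈ (Bj M₁ Z k : DetSet P) I → 1 ≤ I := fun {z I} hz hI => by
    by_contra h
    have hI0 : I = 0 := by omega
    subst hI0
    rw [Bj_zero (by omega)] at hI
    exact hI hz
  have hJ1 := hlev hbs hJ
  have hJ'1 := hlev hbt hJ'
  obtain ⟨⟨L₁, h1len, h1mem, h1end, h1cons⟩, -⟩ := exists_chain_root_centre_lam_graded hM2 hdiv hk hJ1 hJ root (hcentre b.src J hJ)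
  obtain ⟨⟨hJJ1, hJJ2⟩, L₂, h2len, h2mem, h2end, h2cons⟩ := exists_chain_centre_centre_lam_graded hM2 hdiv hk b hJ1 hJ hJ'
  obtain ⟨-, ⟨L₃, h3len, h3mem, h3end, h3cons⟩⟩ := exists_chain_root_centre_lam_graded hM2 hdiv hk hJ'1 hJ' root (hcentre b.tgt J' hJ')
  have h12end : walkEnd (root b.src) ((L₁ ++ L₂).map fun l => List.replicate (P.L ^ l.1) (l.2.1.dir, l.2.2)).flatten = embIter J' (iterBlockOf J' b.tgt) := by
    rw [walkEnd_flatten_append, h1end, h2end]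
  refine ⟨(L₁ ++ L₂) ++ L₃, ?_, ?_, ?_, ?_, ?_⟩
  · rw [List.length_append, List.length_append]; omega
  · intro l hl
    rcases List.mem_append.mp hl with hl | hl
    · rcases List.mem_append.mp hl with hl | hl
      · exact (h1mem l hl).2
      · exact (h2mem l hl).2.2
    · exact (h3mem l hl).2
  · intro l hl
    rcases List.mem_append.mp hl with hl | hl
    · rcases List.mem_append.mp hl with hl | hl
      · have h := (h1mem l hl).1
        exact ⟨h.trans (Nat.le_succ J), by omega⟩
      · exact ⟨(h2mem l hl).1, (h2mem l hl).2.1⟩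
    · have h := (h3mem l hl).1
      exact ⟨by omega, h.trans (Nat.le_succ J')⟩
  · rw [walkEnd_flatten_append, h12end, h3end]
  · refine links_append _ _ _ (links_append _ _ _ h1cons fun pre post l h => ?_) fun pre post l h => ?_
    · rw [h1end]; exact h2cons pre post l h
    · rw [h12end]; exact h3cons pre post l h

/-- ★★★ **(G-c)ᴸᵃᵐ THE ROOT CHAINS AT PRINT's DATUM, UNGRADED** — `N12BjRootChains.exists_rootChain_Bj` binder for binder with the (CENTRE) clause and the memberships read at print's datum
`Λ(Z)`; for every fine bond `b` with both ends in `Ω₁(Z)` a chain of `≤ 3·d·(L−1)∕2 + 5` PRINT-member links of level `≤ k`, consecutive from `root b₋`, ending at `root b₊` (the `Γ`-levels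
of the two ends from `hcov_Bj`, grades dropped). [cite: Balaban1984PropagatorsII, (2.3) p.224; Balaban1988Convergent, (2.2) p.255, (2.13) pp.256–257; Balaban1985Variational, (3)–(4) p.278, (16)–(18) p.280; Balaban1985RegularSpaces, (1.19) p.79] -/
theorem exists_rootChain_lamBondsSeq (hk : k ≤ P.m + P.K) (hk1 : 1 ≤ k) (hM2 : 2 ≤ M₁) (hdiv : side P.L M₁ k ∣ P.sitesPerDir 0) (root : Site P 0 → Site P 0)
    (hcentre : ∀ (z : Site P 0) (J : ℕ), iterBlockOf J z ∈ (Bj M₁ Z k : DetSet P) J →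
      ((1 ≤ J ∧ ∃ c ∈ lamBondsSeq (maxDomT M₁ Z) k (J - 1), (iterBlockOf (J - 1) z = c.src ∨ iterBlockOf (J - 1) z = c.tgt)) ∧
          root z = embIter (J - 1) (iterBlockOf (J - 1) z)) ∨
      (¬ (1 ≤ J ∧ ∃ c ∈ lamBondsSeq (maxDomT M₁ Z) k (J - 1), (iterBlockOf (J - 1) z = c.src ∨ iterBlockOf (J - 1) z = c.tgt)) ∧
          root z = embIter J (iterBlockOf J z)))
    (b : PBond P 0) (hbs : b.src ∈ maxDomT M₁ Z 1) (hbt : b.tgt ∈ maxDomT M₁ Z 1) :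
    ∃ links : List ((m : ℕ) × (PBond P m × Bool)), links.length ≤ 3 * (P.d * ((P.L - 1) / 2)) + 5 ∧
      (∀ l ∈ links, l.1 ≤ k ∧ l.2.1 ∈ lamBondsSeq (maxDomT M₁ Z) k l.1) ∧
      walkEnd (root b.src) (links.map fun l => List.replicate (P.L ^ l.1) (l.2.1.dir, l.2.2)).flatten = root b.tgt ∧
      ∀ (pre post : List ((m : ℕ) × (PBond P m × Bool))) (l : (m : ℕ) × (PBond P m × Bool)), links = pre ++ l :: post →
        (l.2.2 = true → walkEnd (root b.src) (pre.map fun l => List.replicate (P.L ^ l.1) (l.2.1.dir, l.2.2)).flatten = embIter l.1 l.2.1.src) ∧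
        (l.2.2 = false → walkEnd (root b.src) (pre.map fun l => List.replicate (P.L ^ l.1) (l.2.1.dir, l.2.2)).flatten = embIter l.1 l.2.1.tgt) := by
  have hM : 1 ≤ M₁ := by omega
  obtain ⟨J, -, hJ⟩ := hcov_Bj hM hk1 hk hdiv (Z := Z) b.src
  obtain ⟨J', -, hJ'⟩ := hcov_Bj hM hk1 hk hdiv (Z := Z) b.tgt
  obtain ⟨links, hlen, hmem, -, hend, hcons⟩ := exists_rootChain_lamBondsSeq_graded hk hk1 hM2 hdiv root hcentre b hbs hbt hJ hJ'
  exact ⟨links, hlen, hmem, hend, hcons⟩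

/-- ★★★ **ROOT-MAP-FREE EDITION, GRADED**: at print's datum the roots ARE the `Γ`-level centres, so the root chain of a fine bond `b` inside `Ω₁(Z)` with end levels `J`, `J′` is a chain of
`≤ d·(L−1)∕2 + 1` PRINT-member links from `ι_J(B^J b₋)` to `ι_{J′}(B^{J′} b₊)`, grades `≤ J + 1`, `≤ J′ + 1`, `|J − J′| ≤ 1` — `exists_chain_centre_centre_lam_graded` re-exported for the
consumers that key the root map as `z ↦ ι_{J(z)}(B^{J(z)} z)` (no `root`∕`hcentre` binder; `1 ≤ J` from `b₋ ∈ Ω₁(Z)`).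
[cite: Balaban1984PropagatorsII, (2.3) p.224; Balaban1988Convergent, (2.2) p.255, (2.13) pp.256–257; Balaban1985Variational, (16)–(18) p.280; Balaban1985RegularSpaces, (1.7) p.77, (1.19) p.79] -/
theorem exists_rootChain_lamBondsSeq_graded_centre (hk : k ≤ P.m + P.K) (hk1 : 1 ≤ k) (hM2 : 2 ≤ M₁) (hdiv : side P.L M₁ k ∣ P.sitesPerDir 0)
    (b : PBond P 0) (hbs : b.src ∈ maxDomT M₁ Z 1)
    {J J' : ℕ} (hJ : iterBlockOf J b.src ∈ (Bj M₁ Z k : DetSet P) J) (hJ' : iterBlockOf J' b.tgt ∈ (Bj M₁ Z k : DetSet P) J') :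
    (J ≤ J' + 1 ∧ J' ≤ J + 1) ∧ ∃ links : List ((m : ℕ) × (PBond P m × Bool)), links.length ≤ P.d * ((P.L - 1) / 2) + 1 ∧
      (∀ l ∈ links, l.1 ≤ J + 1 ∧ l.1 ≤ J' + 1 ∧ l.1 ≤ k ∧ l.2.1 ∈ lamBondsSeq (maxDomT M₁ Z) k l.1) ∧
      walkEnd (embIter J (iterBlockOf J b.src)) (links.map fun l => List.replicate (P.L ^ l.1) (l.2.1.dir, l.2.2)).flatten = embIter J' (iterBlockOf J' b.tgt) ∧
      ∀ (pre post : List ((m : ℕ) × (PBond P m × Bool))) (l : (m : ℕ) × (PBond P m × Bool)), links = pre ++ l :: post →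
        (l.2.2 = true → walkEnd (embIter J (iterBlockOf J b.src)) (pre.map fun l => List.replicate (P.L ^ l.1) (l.2.1.dir, l.2.2)).flatten = embIter l.1 l.2.1.src) ∧
        (l.2.2 = false → walkEnd (embIter J (iterBlockOf J b.src)) (pre.map fun l => List.replicate (P.L ^ l.1) (l.2.1.dir, l.2.2)).flatten = embIter l.1 l.2.1.tgt) := by
  have hJ1 : 1 ≤ J := by
    by_contra h
    have hJ0 : J = 0 := by omega
    subst hJ0
    rw [Bj_zero (by omega)] at hJ
    exact hJ hbs
  exact exists_chain_centre_centre_lam_graded hM2 hdiv hk b hJ1 hJ hJ'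

/-- ★★ **THE ROOT CHAIN OF A BOND TOUCHING `Ω₁(Z)` — CROSSING BONDS INCLUDED** (the lane's LOCATED-2: at print's datum a bond with ONE end in `Ω₁(Z)` and the other in `Λ₀` is NOT pinned —
it is an inward connector of level `0` —, so the localised gauge letter reads it as a TWO-ROOT bond whose transporter runs through the OUTWARD connector `⟨B¹x → B¹y⟩ ∈ Λ₁` and `Λ₀`-links
inside `B¹(y)`).  For a fine bond `b` with at least one end in `Ω₁(Z)` and end levels `J`, `J′`: `|J − J′| ≤ 1` and a chain of `≤ d·(L−1)∕2 + 1` PRINT-member links, grades `≤ J + 1`,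
`≤ J′ + 1`, from `ι_J(B^J b₋)` to `ι_{J′}(B^{J′} b₊)` — `exists_chain_centre_centre_lam_graded` when `b₋ ∈ Ω₁(Z)`; when `b₋ ∉ Ω₁(Z)` (`J = 0`, and then `J′ = 1` by the collar) the chain
`…N12BjAcrossChainsLam.exists_chain_across_lam_graded` (c) at `n = 0` from `b₋` itself to `ι_1(B¹ b₊)`.
[cite: Balaban1984PropagatorsII, (2.3) p.224; Balaban1988Convergent, (2.2) p.255, (2.13) pp.256–257; Balaban1985Variational, (16)–(18) p.280; Balaban1985RegularSpaces, (1.19) p.79] -/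
theorem exists_rootChain_lamBondsSeq_graded_touching (hk : k ≤ P.m + P.K) (hk1 : 1 ≤ k) (hM2 : 2 ≤ M₁) (hdiv : side P.L M₁ k ∣ P.sitesPerDir 0)
    (b : PBond P 0) (hb : b.src ∈ maxDomT M₁ Z 1 ∨ b.tgt ∈ maxDomT M₁ Z 1)
    {J J' : ℕ} (hJ : iterBlockOf J b.src ∈ (Bj M₁ Z k : DetSet P) J) (hJ' : iterBlockOf J' b.tgt ∈ (Bj M₁ Z k : DetSet P) J') :
    (J ≤ J' + 1 ∧ J' ≤ J + 1) ∧ ∃ links : List ((m : ℕ) × (PBond P m × Bool)), links.length ≤ P.d * ((P.L - 1) / 2) + 1 ∧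
      (∀ l ∈ links, l.1 ≤ J + 1 ∧ l.1 ≤ J' + 1 ∧ l.1 ≤ k ∧ l.2.1 ∈ lamBondsSeq (maxDomT M₁ Z) k l.1) ∧
      walkEnd (embIter J (iterBlockOf J b.src)) (links.map fun l => List.replicate (P.L ^ l.1) (l.2.1.dir, l.2.2)).flatten = embIter J' (iterBlockOf J' b.tgt) ∧
      ∀ (pre post : List ((m : ℕ) × (PBond P m × Bool))) (l : (m : ℕ) × (PBond P m × Bool)), links = pre ++ l :: post →
        (l.2.2 = true → walkEnd (embIter J (iterBlockOf J b.src)) (pre.map fun l => List.replicate (P.L ^ l.1) (l.2.1.dir, l.2.2)).flatten = embIter l.1 l.2.1.src) ∧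
        (l.2.2 = false → walkEnd (embIter J (iterBlockOf J b.src)) (pre.map fun l => List.replicate (P.L ^ l.1) (l.2.1.dir, l.2.2)).flatten = embIter l.1 l.2.1.tgt) := by
  have hM : 1 ≤ M₁ := by omega
  by_cases hbs : b.src ∈ maxDomT M₁ Z 1
  · have hJ1 : 1 ≤ J := by
      by_contra h
      have hJ0 : J = 0 := by omega
      subst hJ0
      rw [Bj_zero (by omega)] at hJ
      exact hJ hbs
    exact exists_chain_centre_centre_lam_graded hM2 hdiv hk b hJ1 hJ hJ'
  · have hbt : b.tgt ∈ maxDomT M₁ Z 1 := hb.resolve_left hbs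
    -- the source has `Γ`-level `0`
    have hJ0' : iterBlockOf 0 b.src ∈ (Bj M₁ Z k : DetSet P) 0 := by rw [Bj_zero (by omega)]; exact hbs
    have hJ0 : J = 0 := eq_of_iterBlockOf_mem_Bj hM hdiv hk hJ hJ0'
    subst hJ0
    -- the target has `Γ`-level exactly `1`: in `Ω₁(Z)`, and adjacent to a site off `Ω₁(Z)` (the collar)
    have hJ'1 : 1 ≤ J' := by
      by_contra h
      have h0 : J' = 0 := by omega
      subst h0
      rw [Bj_zero (by omega)] at hJ'
      exact hJ' hbt
    have hJ'k : J' ≤ k := le_of_iterBlockOf_mem_Bj hJ'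
    have hJ'le : J' ≤ 1 := by
      by_contra h
      have htΩ' : b.tgt ∈ maxDomT M₁ Z J' := mem_maxDomT_of_iterBlockOf_mem_Bj hM hdiv hk hJ'1 hJ'
      have hsΩ' : b.src ∈ maxDomT M₁ Z (J' - 1) :=
        mem_maxDomT_pred_of_blockIdx hM2 hdiv hk hJ'1 hJ'k (i := 0) (Nat.zero_le _) htΩ' (fun κ => idx_adj_of_bond b (Or.inr rfl) (Or.inl rfl) κ)
      exact hbs (maxDomT_antitone hM Z (show 1 ≤ J' - 1 by omega) hsΩ')
    have hJ'eq : J' = 1 := le_antisymm hJ'le hJ'1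
    subst hJ'eq
    have htgt : (b.tgt : Site P 0) = b.src.shift b.dir := rfl
    have hor1 : iterBlockOf 1 b.tgt = iterBlockOf 1 b.src ∨ iterBlockOf 1 b.tgt = (iterBlockOf 1 b.src).shift b.dir := by
      rw [htgt]; exact iterBlockOf_shift_or 1 (by omega) b.src b.dir
    have hne1 : iterBlockOf 1 b.tgt ≠ iterBlockOf 1 b.src := iterBlockOf_ne_of_mem_not_mem hM2 hdiv hk le_rfl hk1 hbt hbs
    have hsh1 : iterBlockOf 1 b.tgt = (iterBlockOf 1 b.src).shift b.dir := hor1.resolve_left hne1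
    obtain ⟨-, -, ⟨links, hlen, hmem, hend, hcons⟩⟩ :=
      exists_chain_across_lam_graded hM2 hdiv hk (n := 0) (by omega) hJ' hbs ⟨iterBlockOf 1 b.src, b.dir⟩ (Or.inr ⟨hsh1.symm, rfl⟩)
    exact ⟨⟨by omega, by omega⟩, links, hlen, fun l hl => ⟨(hmem l hl).1, (hmem l hl).1.trans (by omega), (hmem l hl).2⟩, hend, hcons⟩

end Main

end Summit.QuantumFields.YangMills.BalabanUVNodes.N12BjRootChainsLam

end
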